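import Literature.Claims.NS.Schatz2025
import Literature.Analysis.Calculus.SmoothRepresentativeGlue
import Literature.Analysis.FluidPDE.CKNOneScaleOscillation
import HarnessLib

/-!
# C171 `Schatz2025` — SALVAGE (TRUE column): the Vitali / gluing step `Step_Q` holds

Cell `ns-claims` (D-0090), salvage seat ns-claims-salvage-p2 g6; claim skeleton
`Literature/Claims/NS/Schatz2025.lean` (typist-11 g7, rev 1 p548203). RECORDS-GRADE, TRUE column only: this
file keys nothing (no locator, no verdict).

THE TYPED STEP (`Literature.Claims.NS.Schatz2025.Step_Q`, skeleton l.282; Lemma Q.1 p.50 l.3–14 + Thm R.5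
p.54 l.12–13 «A Vitali subcover gives smoothness on the entire slab», AS USED): if every point of the open slab
`(0,T) × ℝ³` lies in an open parabolic cylinder inside the slab on which `u` is a.e. equal to a jointly `C^∞`
function, then `u` is a.e. equal on the slab to ONE function jointly `C^∞` on `(0,T) × ℝ³`.  It is the binder
`hQ` of the skeleton's `claim_of_steps` / `claim_of_steps_fine` / `clayA_of_steps`.

WHY IT IS TRUE (sheaf bookkeeping, no PDE): two continuous local representatives agree a.e. on the open
overlap of their charts, hence everywhere there (Lebesgue measure charges nonempty open sets); so the
representative of the chart at `z`, evaluated at `z`, is well defined, locally equal to each chart's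
representative (hence `C^∞` on the slab), and a.e. equal to `u` on the slab through a countable subcover.
Kernel: the tree's gluing theorem `Literature.Analysis.Calculus.exists_contDiffOn_ae_eq_of_locally`
(Hörmander ALPDO I, Thm. 2.2.1 / 2.2.4 and the remark after Def. 2.2.3) applied to the open cylinders
`parabolicCylinder r z'` as charts of the open slab.

[cite: Schatz2025, Lemma Q.1 p.50 l.3–14; Thm R.5 proof p.54 l.12–13]
[cite: HormanderALPDO1, Thm. 2.2.1, Thm. 2.2.4, Def. 2.2.3 (remark p. 42)]

WHAT THIS IS NOT: not a claim about NS regularity or blow-up; not a claim about any author beyond the typed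
locator.
-/

set_option linter.dupNamespace false

noncomputable section

open Set Function MeasureTheory Filter TopologicalSpace
open scoped Topology ContDiff

namespace Summit.NavierStokesRegularity.NavierStokesRegularity.Theorems.Schatz2025Salvage

open Literature.Claims.NS.Schatz2025 Literature.Analysis.FluidPDE

/-- The open slab of the skeleton is the product set `(0,T) × ℝ³`. [cite: Schatz2025, Thm 2.1 p.3 l.2–8] -/
theorem coe_slabT (T : ℝ) : (slabT T : Set (ℝ × E3)) = Ioo 0 T ×ˢ (univ : Set E3) := rfl

/-- **`Step_Q` holds** (Lemma Q.1 p.50 + Thm R.5 p.54 l.12–13 as used: local smooth representatives on open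
parabolic cylinders covering the open slab glue to one smooth representative on the slab).
[cite: Schatz2025, Lemma Q.1 p.50 l.3–14; Thm R.5 proof p.54 l.12–13]
[cite: HormanderALPDO1, Thm. 2.2.4] -/
theorem step_Q_holds : Step_Q := by
  intro T u hT hloc
  -- the charts: open cylinders inside the slab carrying a smooth a.e.-representative of `u`
  have h : ∀ x₀ ∈ (slabT T : Set (ℝ × E3)), ∃ U : Set (ℝ × E3), IsOpen U ∧ x₀ ∈ U ∧
      U ⊆ (slabT T : Set (ℝ × E3)) ∧ ∃ w : ℝ × E3 → E3, ContDiffOn ℝ ∞ w U ∧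
        ∀ᵐ x ∂(volume : Measure (ℝ × E3)), x ∈ U → uncurry u x = w x := by
    intro x₀ hx₀
    obtain ⟨z', r, hr, hxz, hsub, w, hw, hae⟩ := hloc x₀ hx₀
    refine ⟨parabolicCylinder r z', isOpen_parabolicCylinder r z', hxz, hsub, uncurry w, hw, ?_⟩
    have hmeas : MeasurableSet (parabolicCylinder r z') := (isOpen_parabolicCylinder r z').measurableSet
    exact ((ae_restrict_iff' hmeas).1 hae).mono fun x hx hxU => (hx hxU).symm
  obtain ⟨W, hW, hae⟩ :=
    Literature.Analysis.Calculus.exists_contDiffOn_ae_eq_of_locally (μ := (volume : Measure (ℝ × E3))) h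
  refine ⟨fun t x => W (t, x), ?_, ?_⟩
  · -- a.e. equality on the slab
    have hmeas : MeasurableSet (slabT T : Set (ℝ × E3)) := (slabT T).isOpen.measurableSet
    exact (ae_restrict_iff' hmeas).2 (hae.mono fun z hz hzS => (hz hzS).symm)
  · -- joint smoothness on `(0,T) × ℝ³`
    show ContDiffOn ℝ ∞ (uncurry fun t x => W (t, x)) (Ioo 0 T ×ˢ (univ : Set E3))
    rw [← coe_slabT]
    exact hW.congr fun z _ => rfl

/-! ### Addendum (after ADJUDICATED #155): the TRUE core of Thm P.1 (`Step_P1`) — ε-regularity to `L^∞` -/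

/-- **The classical core of Theorem P.1 p.48 (ε-regularity), for the class of Theorem 2.1**: there is an
absolute `ε > 0` such that for every solution of the class (`IsSolution T u₀ u p`: Leray–Hopf on `ℝ³` +
CKN-suitable on the open slab), every centre `z` and radius `ρ > 0` with `closure Q_ρ(z)` inside the open slab,
`F(z, ρ) = A + B + P ≤ ε` implies `u ∈ L^∞(Q_{ρ/2}(z))` (Caffarelli–Kohn–Nirenberg 1982, Prop. 1 / Lin 1998, in the
tree's oscillation form `Literature.Analysis.FluidPDE.oneScaleRegularity_osc_slab`, fed with `B + P ≤ F`). This is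
what the published ε-regularity gives at this grain — essential boundedness (hence Hölder continuity and spatial
smoothness by the classical local theory), NOT the joint `C^∞` smoothness on the half-cylinder that the skeleton's
`EpsRegWith` / `SmoothOnCyl` (l.240–256) transcribes from p.48 l.7–9; records-grade, keys nothing.
[cite: Schatz2025, Thm P.1 p.48 l.7–19] [cite: CaffarelliKohnNirenberg1982, Proposition 1 and Corollary] -/
theorem epsReg_essBdd : ∃ ε : ℝ, 0 < ε ∧
    ∀ (T : ℝ) (u₀ : E3 → E3) (u : ℝ → E3 → E3) (p : ℝ → E3 → ℝ), IsSolution T u₀ u p →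
      ∀ (z : ℝ × E3) (ρ : ℝ), 0 < ρ →
        closure (parabolicCylinder ρ z) ⊆ (slabT T : Set (ℝ × E3)) →
        Ffun ρ z u p ≤ ENNReal.ofReal ε →
        eLpNorm (uncurry u) ⊤ (volume.restrict (parabolicCylinder (ρ / 2) z)) < ⊤ := by
  obtain ⟨ε₀, hε₀, H⟩ := Literature.Analysis.FluidPDE.oneScaleRegularity_osc_slab
  refine ⟨ε₀, hε₀, fun T u₀ u p hsol z ρ hρ hcl hF => ?_⟩
  have hsmall : cknC ρ z u + cknDOsc ρ z p ≤ ENNReal.ofReal ε₀ := by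
    refine le_trans ?_ hF
    unfold Ffun
    calc cknC ρ z u + cknDOsc ρ z p ≤ cknA ρ z u + (cknC ρ z u + cknDOsc ρ z p) := le_add_self
      _ = cknA ρ z u + cknC ρ z u + cknDOsc ρ z p := (add_assoc _ _ _).symm
  exact H (Ioo 0 T) isOpen_Ioo u p hsol.suitable z ρ hρ (by rwa [coe_slabT] at hcl) hsmall

end Summit.NavierStokesRegularity.NavierStokesRegularity.Theorems.Schatz2025Salvage

end
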